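import Summits.AtomisticToContinuum.Crystallization.Theses.PricedLinkCensus
import Summits.AtomisticToContinuum.Crystallization.Theorems.ChargedEnergyGap.Negative.BlocksBound

/-!
# Route PricedLinkCensus — item `CrysEnergyUpper` (stmt-AtomisticToContinuum-11865)

The trial-state upper bound for the Lennard-Jones ground-state energy in `ℝ³`:

  `limsup_{N → ∞} E(N)/N ≤ ⨅_{Q periodic} e_LJ(Q)`.

For every periodic configuration `Q` the per-configuration bound `limsup E(N)/N ≤ e(Q)` is
`ChargedEnergyGapNegative.limsup_div_le_energyPerParticle` (blocks of `Q` are finite trial states,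
`E(block) ≤ #block · (e(Q) + ε)`, boundary `O(K²)` of `K³`, summable `r⁻⁶` tails; the limsup is the
thermodynamic limit `e_∞` by `BlancLewin2015_8_holds`).  The item is its `le_ciInf`
(`PeriodicConfiguration 3` is nonempty: the simple cubic lattice).  [folklore]
-/

namespace Summit.AtomisticToContinuum.Crystallization.Theorems

open Literature.MathematicalPhysics.StatisticalMechanics

/-- **Item `CrysEnergyUpper`** (stmt-AtomisticToContinuum-11865, route PricedLinkCensus):
`limsup_{N} E_LJ(N)/N ≤ ⨅_{Q : PeriodicConfiguration 3} e_LJ(Q)` — the infimum over periodic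
configurations of the energy per particle bounds the ground-state energy per particle from above
(trial states = large blocks of `Q`). [folklore] -/
theorem crysEnergyUpper_proof : Theses.PricedLinkCensus.CrysEnergyUpper := by
  unfold Theses.PricedLinkCensus.CrysEnergyUpper
  exact le_ciInf ChargedEnergyGapNegative.limsup_div_le_energyPerParticle

end Summit.AtomisticToContinuum.Crystallization.Theorems
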